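import Summits.AnomalousDissipation.AnomalousDissipation.Theses.DopplerClock
import Literature.Analysis.FluidPDE.LinearizedNSTorus
import Literature.Analysis.FluidPDE.TorusClassicalLerayHopfProofs
import Summits.AnomalousDissipation.AnomalousDissipation.Theorems.DopplerClockDopplerWorkIdentity

/-!
# Strategy census companion — crux `DopplerClock.QuadratureStressFloor` (stmt-AnomalousDissipation-18129)

Typed forms of the statements weighed in `Cruxes/QuadratureStressFloor/STRATEGY-CENSUS.md`
(crux-strategist before the lead, 2026-08-17). Everything here elaborates; the glue that is cheap is
PROVED (no `sorry`), the rest is only TYPED (a `def … : Prop`) and flagged as such in its docstring.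

* §0 vocabulary: the route's force `f = F sin(2πm x₁) cos(2πn x₂) e₀`, the quadrature pattern `Ψ_s`,
  the drift `V e₂`, the laminar streak array `u_L(ν)` (item `LaminarStreaks`), the statistics
  `injection`, `stressS` (= `T_s(w)`, `w = u − V e₂`); `crux_iff` (the crux BY NAME in this vocabulary,
  `Iff.rfl`).
* §S (Strengthen): `SteadyStressFloorStates` (loud STEADY drift states) and
  `RelativeEquilibriumStressFloorStates` (x₀-travelling waves); `crux_of_steady` PROVED
  (steady classical ⇒ global Leray–Hopf from itself, constant energy, no-leak WITH EQUALITY by the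
  steady energy identity, constant Cesàro means); `relEq_of_steady` PROVED; the STEADY form of the
  landed identity `steady_work_identity` (from `dopplerWorkIdentity_proof`, item 18133) and its
  consequence `steady_stressFloor_of_dissipationFloor` / `crux_of_loudSteady`: on rigid states a
  DISSIPATION floor `ε ≤ ν‖∇U‖²` with `νκ²|(Ψ_s,U)| ≤ δ < (2πnV/F)ε` IS a stress floor, so
  `SteadyLoudDriftStates → QuadratureStressFloor` (PROVED).
* §S-existence (after kit j023236): `IsR2Symmetric`, `LaminarPitchforkPoint`, `SecondarySteadyDriftStates`
  (typed, provable-class: real ν-uniform pitchfork crossings for m = 2 or n = 2), `SecondaryBranchLoud`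
  (typed; the open core, under kit test j023469).
* §D (Decomposition): `UniformStreakInstability` — the first lemma of the instability line as a
  signature over `Torus.IsLinNSEigenvalue`; `SaturationStep` — the complementary piece, which is the
  whole crux (typed only, NOT filed).
* §T (Transfer / route-level reading): `NoLeakInjectionFloorFamily` (X minus the uniform mean-energy
  clause, plus no-leak) and the typed claim `injectionFloor_gives_crux` (provable from the landed
  `DopplerWorkIdentity`; not proved here).
* §N (Negation): `not_crux_iff` — the sweep-decorrelation FORMAT a disproof must meet (PROVED, `push_neg`).
-/

set_option linter.dupNamespace false
set_option linter.unusedVariables false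

noncomputable section

namespace Summit.AnomalousDissipation.AnomalousDissipation.Cruxes.QuadratureStressFloor.StrategyCensus

open scoped Topology InnerProductSpace
open Filter Set MeasureTheory
open Summit.AnomalousDissipation.AnomalousDissipation.Theses.DopplerClock
open Literature.Analysis.FluidPDE Literature.Analysis.FluidPDE.Torus
open Literature.Analysis.FunctionSpaces Literature.Analysis.FunctionSpaces.Torus

local notation "𝕋³" => UnitAddTorus (Fin 3)
local notation "E³" => EuclideanSpace ℝ (Fin 3)

/-! ## §0 Vocabulary -/

/-- The route's force `f = F sin(2πm x₁) cos(2πn x₂) e₀` (character-for-character the crux's). [folklore] -/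
def force (F : ℝ) (m n : ℕ) : 𝕋³ → E³ := fun x =>
  (F * (UnitAddTorus.mFourier (Pi.single (1 : Fin 3) (m : ℤ)) x).im *
      (UnitAddTorus.mFourier (Pi.single (2 : Fin 3) (n : ℤ)) x).re) •
    EuclideanSpace.single (0 : Fin 3) (1 : ℝ)

/-- The quadrature streak pattern `Ψ_s = sin(2πm x₁) sin(2πn x₂) e₀`. [folklore] -/
def psiS (m n : ℕ) : 𝕋³ → E³ := fun y =>
  ((UnitAddTorus.mFourier (Pi.single (1 : Fin 3) (m : ℤ)) y).im *
      (UnitAddTorus.mFourier (Pi.single (2 : Fin 3) (n : ℤ)) y).im) •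
    EuclideanSpace.single (0 : Fin 3) (1 : ℝ)

/-- The drift (conserved momentum) `V e₂`. [folklore] -/
def drift (V : ℝ) : E³ := V • EuclideanSpace.single (2 : Fin 3) (1 : ℝ)

/-- The injection `(f, v)`. [folklore] -/
def injection (F : ℝ) (m n : ℕ) (v : 𝕋³ → E³) : ℝ := ∫ x, ⟪force F m n x, v x⟫_ℝ

/-- The quadrature stress `T_s(w) = ∫ ⟪w, (w·∇)Ψ_s⟫`, `w = v − V e₂` (production of the fluctuation on
the frozen streak profile is `−(F/2πnV)·T_s`). [folklore] -/
def stressS (V : ℝ) (m n : ℕ) (v : 𝕋³ → E³) : ℝ :=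
  ∫ x, ⟪v x - drift V, convect (fun y => v y - drift V) (psiS m n) x⟫_ℝ

/-- The laminar streak array `u_L(ν) = V e₂ + sin(2πm x₁)[a cos(2πn x₂) + b sin(2πn x₂)] e₀` of item
`LaminarStreaks` (`a = Fνκ²/D`, `b = FV(2πn)/D`, `D = V²(2πn)² + ν²κ⁴`, `κ² = 4π²(m²+n²)`). [folklore] -/
def laminar (F V ν : ℝ) (m n : ℕ) : 𝕋³ → E³ := fun x =>
  V • EuclideanSpace.single (2 : Fin 3) (1 : ℝ) +
    ((UnitAddTorus.mFourier (Pi.single (1 : Fin 3) (m : ℤ)) x).im *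
        ((F * ν * ((2 * Real.pi) ^ 2 * ((m : ℝ) ^ 2 + (n : ℝ) ^ 2)) /
              (V ^ 2 * (2 * Real.pi * n) ^ 2 + ν ^ 2 * ((2 * Real.pi) ^ 2 * ((m : ℝ) ^ 2 + (n : ℝ) ^ 2)) ^ 2)) *
            (UnitAddTorus.mFourier (Pi.single (2 : Fin 3) (n : ℤ)) x).re +
          (F * V * (2 * Real.pi * n) /
              (V ^ 2 * (2 * Real.pi * n) ^ 2 + ν ^ 2 * ((2 * Real.pi) ^ 2 * ((m : ℝ) ^ 2 + (n : ℝ) ^ 2)) ^ 2)) *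
            (UnitAddTorus.mFourier (Pi.single (2 : Fin 3) (n : ℤ)) x).im)) •
      EuclideanSpace.single (0 : Fin 3) (1 : ℝ)

/-- The crux BY NAME in this vocabulary (definitional). [folklore] -/
theorem crux_iff :
    QuadratureStressFloor ↔
      ∃ (F V : ℝ) (m n : ℕ), 0 < F ∧ 0 < V ∧ 0 < m ∧ 0 < n ∧ ∃ Λ : GeneralizedLimit,
        ∃ (ν : ℕ → ℝ) (u₀ : ℕ → 𝕋³ → E³) (u : ℕ → ℝ → 𝕋³ → E³),
          (∀ j, 0 < ν j) ∧ Tendsto ν atTop (𝓝 0) ∧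
          (∀ j, IsGlobalLerayHopf (ν j) (fun _ => force F m n) (u₀ j) (u j)) ∧
          (∀ j, ∫ x, u₀ j x = drift V) ∧
          (∀ j, ∃ C : ℝ, ∀ t : ℝ, 0 ≤ t → kineticEnergy (u j t) ≤ C) ∧
          (∀ j, longTimeAvgSup (fun t => injection F m n (u j t)) ≤ meanDissipation (ν j) (u j)) ∧
          ∃ ε₀ : ℝ, 0 < ε₀ ∧ ∀ j, ε₀ ≤ -Λ.longTimeAvg (fun t => stressS V m n (u j t)) :=
  Iff.rfl

/-! ## Junk-free calculus of constant-in-time observables (steady witnesses have honest means) -/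

/-- Cesàro mean of a constant over `[0,T]`, `T ≠ 0`. [folklore] -/
theorem timeMean_const {c T : ℝ} (hT : T ≠ 0) : timeMean (fun _ => c) T = c := by
  unfold timeMean
  rw [intervalIntegral.integral_const, sub_zero, smul_eq_mul, ← mul_assoc, inv_mul_cancel₀ hT, one_mul]

/-- The Cesàro means of a constant tend to it. [folklore] -/
theorem tendsto_timeMean_const (c : ℝ) : Tendsto (timeMean fun _ => c) atTop (𝓝 c) := by
  refine tendsto_const_nhds.congr' ?_
  filter_upwards [eventually_gt_atTop 0] with T hT
  exact (timeMean_const (c := c) hT.ne').symm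

/-- `⟨c⟩⁺ = c`. [folklore] -/
theorem longTimeAvgSup_const (c : ℝ) : longTimeAvgSup (fun _ => c) = c :=
  (tendsto_timeMean_const c).limsup_eq

/-- `⟨c⟩_Λ = c` for every generalized limit. [folklore] -/
theorem longTimeAvg_const (Λ : GeneralizedLimit) (c : ℝ) : Λ.longTimeAvg (fun _ => c) = c :=
  Λ.longTimeAvg_eq_of_tendsto (tendsto_timeMean_const c)

/-- The steady energy identity `ν‖∇u‖² = (f, u)` for a classical steady state. [folklore] -/
theorem steady_energy_identity {ν : ℝ} {f u : 𝕋³ → E³} {p : 𝕋³ → ℝ}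
    (h : IsClassicalNSSolutionOn Set.univ ν (fun _ => f) (fun _ => u) (fun _ => p)) :
    ν * gradNormSq u = ∫ x, ⟪f x, u x⟫_ℝ := by
  have hE := h.energy_eq convex_univ (zero_le_one (α := ℝ)) (Set.subset_univ _)
  simp only [intervalIntegral.integral_const, sub_zero, one_smul] at hE
  linarith

/-! ## §S Strengthen — rigid (steady / relative-equilibrium) witnesses -/

/-- **S⁺_steady (typed; conjecture-class).** For some design `(F,V,m,n)` there are `ν_j → 0⁺` and
smooth STEADY states `u_j` of `NS_{ν_j}(f)` with momentum `V e₂` and a quadrature stress floor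
`ε₀ ≤ −T_s(u_j − V e₂)`. Energy is NOT bounded (as in the crux). [folklore] -/
def SteadyStressFloorStates : Prop :=
  ∃ (F V : ℝ) (m n : ℕ), 0 < F ∧ 0 < V ∧ 0 < m ∧ 0 < n ∧
    ∃ (ν : ℕ → ℝ) (u : ℕ → 𝕋³ → E³) (p : ℕ → 𝕋³ → ℝ),
      (∀ j, 0 < ν j) ∧ Tendsto ν atTop (𝓝 0) ∧
      (∀ j, IsSteadyNSState (ν j) (force F m n) (u j) (p j)) ∧
      (∀ j, ∫ x, u j x = drift V) ∧
      ∃ ε₀ : ℝ, 0 < ε₀ ∧ ∀ j, ε₀ ≤ -stressS V m n (u j)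

/-- **S⁺_relEq (typed; conjecture-class).** The same with RELATIVE EQUILIBRIA: classical solutions
`u_j(t, x) = U_j(x − c_j t e₀)` travelling along the symmetry direction `x₀` (the generic product
of an `O(2)`-Hopf bifurcation of the `x₀`-invariant laminar streaks); all quadratic statistics of a
relative equilibrium are constant in time. [folklore] -/
def RelativeEquilibriumStressFloorStates : Prop :=
  ∃ (F V : ℝ) (m n : ℕ), 0 < F ∧ 0 < V ∧ 0 < m ∧ 0 < n ∧
    ∃ (ν c : ℕ → ℝ) (U : ℕ → 𝕋³ → E³) (p : ℕ → ℝ → 𝕋³ → ℝ),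
      (∀ j, 0 < ν j) ∧ Tendsto ν atTop (𝓝 0) ∧
      (∀ j, IsClassicalNSSolutionOn Set.univ (ν j) (fun _ => force F m n)
          (fun t x => U j (x - Pi.single (0 : Fin 3) (((c j * t : ℝ)) : UnitAddCircle))) (p j)) ∧
      (∀ j, ∫ x, U j x = drift V) ∧
      ∃ ε₀ : ℝ, 0 < ε₀ ∧ ∀ j, ε₀ ≤ -stressS V m n (U j)

/-- **Steady loud drift states prove the crux** (PROVED): a classical steady state is a global
Leray–Hopf solution from itself (`IsClassicalNSSolutionOn.isGlobalLerayHopf`), its energy is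
constant, the no-leak clause holds WITH EQUALITY (`(f,u) = ν‖∇u‖²`, steady energy identity, and
`‖∇u‖² = ‖∇u‖²_spectral` on smooth fields), and every long-time mean of a constant observable is that
constant — for ANY generalized limit `Λ`. [folklore] -/
theorem crux_of_steady (h : SteadyStressFloorStates) : QuadratureStressFloor := by
  obtain ⟨F, V, m, n, hF, hV, hm, hn, ν, u, p, hν, hν0, hst, hmom, ε₀, hε₀, hfloor⟩ := h
  obtain ⟨Λ⟩ := GeneralizedLimit.nonempty_holds
  rw [crux_iff]
  refine ⟨F, V, m, n, hF, hV, hm, hn, Λ, ν, u, fun j _ => u j, hν, hν0, fun j => (hst j).isGlobalLerayHopf,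
    hmom, fun j => ⟨kineticEnergy (u j), fun t _ => le_rfl⟩, fun j => ?_, ε₀, hε₀, fun j => ?_⟩
  · -- no-leak with equality
    have hsm : IsSmooth (u j) := (hst j).smooth_velocity.isSmooth_slice (Set.mem_univ (0 : ℝ))
    have hid : ν j * gradNormSq (u j) = injection F m n (u j) := steady_energy_identity (hst j)
    show longTimeAvgSup (fun _ : ℝ => injection F m n (u j)) ≤
      longTimeAvgSup (fun _ : ℝ => ν j * (eGradNormSq (u j)).toReal)
    rw [longTimeAvgSup_const, longTimeAvgSup_const, ← gradNormSq_eq_toReal_eGradNormSq_holds hsm, hid]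
  · show ε₀ ≤ -Λ.longTimeAvg (fun _ : ℝ => stressS V m n (u j))
    rw [longTimeAvg_const]
    exact hfloor j

/-- Steady states are relative equilibria with speed `0` (PROVED). [folklore] -/
theorem relEq_of_steady (h : SteadyStressFloorStates) : RelativeEquilibriumStressFloorStates := by
  obtain ⟨F, V, m, n, hF, hV, hm, hn, ν, u, p, hν, hν0, hst, hmom, ε₀, hε₀, hfloor⟩ := h
  refine ⟨F, V, m, n, hF, hV, hm, hn, ν, fun _ => 0, u, fun j _ => p j, hν, hν0, fun j => ?_, hmom, ε₀,
    hε₀, hfloor⟩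
  have : (fun (t : ℝ) (x : 𝕋³) => u j (x - Pi.single (0 : Fin 3) ((((0 : ℝ) * t : ℝ)) : UnitAddCircle))) =
      fun _ => u j := by
    funext t x
    simp
  rw [this]
  exact hst j

/-! ### The steady form of the landed identity: on rigid states "loud" is ONE signed functional -/

/-- The quadrature streak coefficient `B(v) = (Ψ_s, v)`. [folklore] -/
def quadB (m n : ℕ) (v : 𝕋³ → E³) : ℝ := ∫ x, ⟪psiS m n x, v x⟫_ℝ

/-- **Steady Doppler work identity** (PROVED from the landed `dopplerWorkIdentity_proof`, item 18133):
for a smooth steady state `U` of `NS_ν(f)` (any momentum), `(f,U) = F/(V·2πn)·(νκ²(Ψ_s,U) − T_s(U − Ve₂))` —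
the rotation identity `B' = ωA + T_s − νκ²B` with `B' = 0`. [folklore] -/
theorem steady_work_identity {F V ν : ℝ} {m n : ℕ} {U : 𝕋³ → E³} {p : 𝕋³ → ℝ}
    (hV : 0 < V) (hν : 0 < ν) (hn : 0 < n) (hst : IsSteadyNSState ν (force F m n) U p)
    (hmom : ∫ x, U x = drift V) :
    injection F m n U =
      F / (V * (2 * Real.pi * n)) *
        (ν * ((2 * Real.pi) ^ 2 * ((m : ℝ) ^ 2 + (n : ℝ) ^ 2)) * quadB m n U - stressS V m n U) := by
  obtain ⟨Λ⟩ := GeneralizedLimit.nonempty_holds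
  have h := Summit.AnomalousDissipation.AnomalousDissipation.Theorems.dopplerWorkIdentity_proof Λ F V ν m n U
    (fun _ => U) hV hν hn hst.isGlobalLerayHopf hmom ⟨kineticEnergy U, fun t _ => le_rfl⟩
  simp only [longTimeAvg_const] at h
  exact h

/-- **On steady drift states a DISSIPATION floor is a quadrature STRESS floor** (PROVED): if
`ε ≤ ν‖∇U‖²` and `νκ²·|(Ψ_s,U)| ≤ δ` then `(2πnV/F)·ε − δ ≤ −T_s(U − Ve₂)` (steady energy identity
`ν‖∇U‖² = (f,U)` + `steady_work_identity`). So loudness of rigid witnesses is the sign/size of ONE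
quadratic functional, and energies up to `o(ν⁻²)` are harmless. [folklore] -/
theorem steady_stressFloor_of_dissipationFloor {F V ν ε δ : ℝ} {m n : ℕ} {U : 𝕋³ → E³} {p : 𝕋³ → ℝ}
    (hF : 0 < F) (hV : 0 < V) (hν : 0 < ν) (hn : 0 < n) (hst : IsSteadyNSState ν (force F m n) U p)
    (hmom : ∫ x, U x = drift V) (hε : ε ≤ ν * gradNormSq U)
    (hδ : ν * ((2 * Real.pi) ^ 2 * ((m : ℝ) ^ 2 + (n : ℝ) ^ 2)) * |quadB m n U| ≤ δ) :
    V * (2 * Real.pi * n) / F * ε - δ ≤ -stressS V m n U := by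
  have hid : ν * gradNormSq U = injection F m n U := steady_energy_identity hst
  have hw := steady_work_identity hV hν hn hst hmom
  set κ2 : ℝ := (2 * Real.pi) ^ 2 * ((m : ℝ) ^ 2 + (n : ℝ) ^ 2) with hκ2
  set ω : ℝ := V * (2 * Real.pi * n) with hω
  have hn' : (0 : ℝ) < n := by exact_mod_cast hn
  have hωpos : 0 < ω := by rw [hω]; positivity
  have hκ2 : 0 ≤ κ2 := by rw [hκ2]; positivity
  -- `−T_s = (ω/F)·(f,U) − νκ²B`
  have hT : -stressS V m n U = ω / F * injection F m n U - ν * κ2 * quadB m n U := by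
    rw [hw]
    field_simp
    ring
  have hB : -(ν * κ2 * quadB m n U) ≥ -δ := by
    have h1 : ν * κ2 * quadB m n U ≤ ν * κ2 * |quadB m n U| :=
      mul_le_mul_of_nonneg_left (le_abs_self _) (mul_nonneg hν.le hκ2)
    linarith
  have hI : ω / F * ε ≤ ω / F * injection F m n U :=
    mul_le_mul_of_nonneg_left (hid ▸ hε) (div_nonneg hωpos.le hF.le)
  rw [hT]
  have : V * (2 * Real.pi * ↑n) / F * ε = ω / F * ε := by rw [hω]
  linarith

/-- **S⁺ in dissipation form (typed): loud steady drift states.** Some design, `ν_j → 0⁺`, smooth steady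
states with momentum `V e₂`, a ν-uniform DISSIPATION floor `ε ≤ ν_j‖∇u_j‖²`, and the mild size condition
`ν_j κ² |(Ψ_s,u_j)| ≤ δ` with `δ < (2πnV/F)·ε` (energies `o(ν⁻²)` suffice). [folklore] -/
def SteadyLoudDriftStates : Prop :=
  ∃ (F V : ℝ) (m n : ℕ), 0 < F ∧ 0 < V ∧ 0 < m ∧ 0 < n ∧
    ∃ (ν : ℕ → ℝ) (u : ℕ → 𝕋³ → E³) (p : ℕ → 𝕋³ → ℝ),
      (∀ j, 0 < ν j) ∧ Tendsto ν atTop (𝓝 0) ∧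
      (∀ j, IsSteadyNSState (ν j) (force F m n) (u j) (p j)) ∧
      (∀ j, ∫ x, u j x = drift V) ∧
      ∃ ε δ : ℝ, 0 < ε ∧ δ < V * (2 * Real.pi * n) / F * ε ∧
        (∀ j, ε ≤ ν j * gradNormSq (u j)) ∧
        ∀ j, ν j * ((2 * Real.pi) ^ 2 * ((m : ℝ) ^ 2 + (n : ℝ) ^ 2)) * |quadB m n (u j)| ≤ δ

/-- Loud steady drift states have a quadrature stress floor (PROVED), hence prove the crux
(`crux_of_steady`). [folklore] -/
theorem steadyStressFloor_of_loud (h : SteadyLoudDriftStates) : SteadyStressFloorStates := by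
  obtain ⟨F, V, m, n, hF, hV, hm, hn, ν, u, p, hν, hν0, hst, hmom, ε, δ, hε, hδε, hfl, hB⟩ := h
  refine ⟨F, V, m, n, hF, hV, hm, hn, ν, u, p, hν, hν0, hst, hmom, V * (2 * Real.pi * n) / F * ε - δ,
    by linarith, fun j => ?_⟩
  exact steady_stressFloor_of_dissipationFloor hF hV (hν j) hn (hst j) (hmom j) (hfl j) (hB j)

/-- COMPOSITION (PROVED): loud steady drift states ⟹ the crux by name. [folklore] -/
theorem crux_of_loudSteady (h : SteadyLoudDriftStates) : QuadratureStressFloor :=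
  crux_of_steady (steadyStressFloor_of_loud h)

/-! ### Existence side of the steady line (after kit j023236: REAL, ν-uniform pitchfork crossings for m = 2 or n = 2) -/

/-- The reflection `R₂ : x ↦ Sx`, `S = diag(−1,−1,1)`, on the torus. [folklore] -/
def reflS (x : 𝕋³) : 𝕋³ := fun i => if i = 2 then x i else -x i

/-- `S = diag(−1,−1,1)` on velocity values. [folklore] -/
def vecS (v : E³) : E³ := !₂[-(v 0), -(v 1), v 2]

/-- `u` is `R₂`-symmetric: `S u(Sx) = u(x)`, i.e. `u(Sx) = S u(x)` (the force `f`, the drift `V e₂` and the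
laminar streaks are `R₂`-symmetric; in `Fix(R₂)` the `x₀`-phase orbit of a pitchfork of revolution is cut
to a point and the real crossing is simple). [folklore] -/
def IsR2Symmetric (u : 𝕋³ → E³) : Prop := ∀ x, u (reflS x) = vecS (u x)

/-- **Bifurcation of steady drift states from the laminar branch (typed; provable-class given a certified
simple real crossing — Crandall–Rabinowitz / Krasnosel'skii odd crossing in `Fix(R₂)`):** for some design
there is `ν_c > 0` such that NON-laminar `R₂`-symmetric steady drift states accumulate at `(ν_c, u_L(ν_c))`.
Kit j023236: real simple-in-sector crossings at `ν_c ≈ 0.01` (streak units) for (1,2) G=4 and (2,1) G=16. [folklore] -/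
def LaminarPitchforkPoint : Prop :=
  ∃ (F V : ℝ) (m n : ℕ), 0 < F ∧ 0 < V ∧ 0 < m ∧ 0 < n ∧ ∃ ν_c : ℝ, 0 < ν_c ∧
    ∀ ε : ℝ, 0 < ε → ∃ (ν : ℝ) (u : 𝕋³ → E³) (p : 𝕋³ → ℝ), |ν - ν_c| < ε ∧ 0 < ν ∧
      IsSteadyNSState ν (force F m n) u p ∧ (∫ x, u x = drift V) ∧ IsR2Symmetric u ∧
      u ≠ laminar F V ν m n ∧ ∀ x, ‖u x - laminar F V ν m n x‖ < ε

/-- **Secondary steady drift states for all small ν (typed; provable-class modulo certified spectral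
counts: Leray–Schauder index −1 of the laminar state in `Fix(R₂)` on ν-intervals with an odd number of real
unstable modes, or Rabinowitz's global alternative (i) for the pitchfork continuum):** for some design and
all `0 < ν < ν₀` there is an `R₂`-symmetric steady drift state different from the laminar one (hence
`x₀`-dependent, the `x₀`-invariant steady class being `{u_L(ν)}`). [folklore] -/
def SecondarySteadyDriftStates : Prop :=
  ∃ (F V : ℝ) (m n : ℕ), 0 < F ∧ 0 < V ∧ 0 < m ∧ 0 < n ∧ ∃ ν₀ : ℝ, 0 < ν₀ ∧
    ∀ ν : ℝ, 0 < ν → ν < ν₀ → ∃ (u : 𝕋³ → E³) (p : 𝕋³ → ℝ),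
      IsSteadyNSState ν (force F m n) u p ∧ (∫ x, u x = drift V) ∧ IsR2Symmetric u ∧ u ≠ laminar F V ν m n

/-- **The open core of the steady line (typed; conjecture-class, under kit test j023469): the secondary
steady drift states are LOUD along a vanishing-viscosity sequence** — a dissipation floor with the mild size
condition of `SteadyLoudDriftStates`. Recorded as the implication the line would need. [folklore] -/
def SecondaryBranchLoud : Prop :=
  SecondarySteadyDriftStates → SteadyLoudDriftStates

/-! ## §D Decomposition — the instability line's first lemma, and the piece that stays the crux -/

/-- **First lemma of the instability line (typed; provable-class, certified numerics + perturbation):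
ν-UNIFORM LINEAR INSTABILITY of the laminar streak array with drift.** For some design there are
`σ₀, ν₀ > 0` such that for every `0 < ν < ν₀` the linearised Navier–Stokes operator at `u_L(ν)`
(`Torus.linearizedNSOperator`, eigenvalue notion `Torus.IsLinNSEigenvalue`) has an eigenvalue of
real part `≥ σ₀`. Kit j023208 (this seat) measures the leading growth rates. [folklore] -/
def UniformStreakInstability : Prop :=
  ∃ (F V : ℝ) (m n : ℕ), 0 < F ∧ 0 < V ∧ 0 < m ∧ 0 < n ∧
    ∃ σ₀ ν₀ : ℝ, 0 < σ₀ ∧ 0 < ν₀ ∧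
      ∀ ν : ℝ, 0 < ν → ν < ν₀ → ∃ μ : ℂ, IsLinNSEigenvalue ν (laminar F V ν m n) μ ∧ σ₀ ≤ μ.re

/-- **The complementary piece (typed only; NOT filed): instability ⇒ a loud no-leak family.**
This is the whole crux again (saturation / long-time statistics of 3-D Navier–Stokes at `ν → 0`);
recorded to make the census's "which piece remains the crux" precise. [folklore] -/
def SaturationStep : Prop :=
  UniformStreakInstability → QuadratureStressFloor

/-! ## §T Transfer / route-level reading — the crux is "X minus uniform energy, plus no-leak" -/

/-- **No-leak injection-floor family with ν-uniform energy (typed).** In the world of the route's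
other crux `InjectionControlsEnergy` every drift-`V` Leray–Hopf family has ν-uniform mean energy, and
the crux is equivalent (via the landed `DopplerWorkIdentity`) to an INJECTION floor along a no-leak
family — the zeroth law for this force at pinned momentum with no-leak witnesses. [folklore] -/
def NoLeakInjectionFloorFamily : Prop :=
  ∃ (F V : ℝ) (m n : ℕ), 0 < F ∧ 0 < V ∧ 0 < m ∧ 0 < n ∧ ∃ Λ : GeneralizedLimit,
    ∃ (ν : ℕ → ℝ) (u₀ : ℕ → 𝕋³ → E³) (u : ℕ → ℝ → 𝕋³ → E³),
      (∀ j, 0 < ν j) ∧ Tendsto ν atTop (𝓝 0) ∧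
      (∀ j, IsGlobalLerayHopf (ν j) (fun _ => force F m n) (u₀ j) (u j)) ∧
      (∀ j, ∫ x, u₀ j x = drift V) ∧
      (∃ C : ℝ, ∀ j, ∀ t : ℝ, 0 ≤ t → kineticEnergy (u j t) ≤ C) ∧
      (∀ j, longTimeAvgSup (fun t => injection F m n (u j t)) ≤ meanDissipation (ν j) (u j)) ∧
      ∃ η : ℝ, 0 < η ∧ ∀ j, η ≤ Λ.longTimeAvg (fun t => injection F m n (u j t))

/-- **Typed claim (provable from the landed `DopplerWorkIdentity`, ~250 lines of Banach-mean
bookkeeping as in `DopplerClockCruxesGiveTarget`; NOT proved here):** a no-leak injection-floor family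
with ν-uniform energy gives the crux (`−Λ⟨T_s⟩ = (2πnV/F)Λ⟨(f,u)⟩ − νκ²Λ⟨(u,Ψ_s)⟩ ≥ (2πnV/F)η − O(ν)`,
then drop finitely many `j`). [folklore] -/
def injectionFloor_gives_crux : Prop :=
  NoLeakInjectionFloorFamily → QuadratureStressFloor

/-! ## §N Negation — the format a disproof must meet -/

/-- **Sweep decorrelation, as a format (PROVED equivalent to `¬ crux`):** for EVERY design, EVERY
generalized limit and EVERY drift-`V` no-leak Leray–Hopf family with per-`j` energy bounds, the
quadrature production has no positive floor: `∀ ε₀ > 0 ∃ j, −Λ⟨T_s(w_j)⟩ < ε₀`. [folklore] -/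
theorem not_crux_iff :
    ¬ QuadratureStressFloor ↔
      ∀ (F V : ℝ) (m n : ℕ), 0 < F → 0 < V → 0 < m → 0 < n → ∀ Λ : GeneralizedLimit,
        ∀ (ν : ℕ → ℝ) (u₀ : ℕ → 𝕋³ → E³) (u : ℕ → ℝ → 𝕋³ → E³),
          (∀ j, 0 < ν j) → Tendsto ν atTop (𝓝 0) →
          (∀ j, IsGlobalLerayHopf (ν j) (fun _ => force F m n) (u₀ j) (u j)) →
          (∀ j, ∫ x, u₀ j x = drift V) →
          (∀ j, ∃ C : ℝ, ∀ t : ℝ, 0 ≤ t → kineticEnergy (u j t) ≤ C) →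
          (∀ j, longTimeAvgSup (fun t => injection F m n (u j t)) ≤ meanDissipation (ν j) (u j)) →
          ∀ ε₀ : ℝ, 0 < ε₀ → ∃ j, -Λ.longTimeAvg (fun t => stressS V m n (u j t)) < ε₀ := by
  rw [crux_iff]
  push Not
  rfl

end Summit.AnomalousDissipation.AnomalousDissipation.Cruxes.QuadratureStressFloor.StrategyCensus

end
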